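import Mathlib
import HarnessLib

/-!
# Upper Integral FTC for Remainder0Xi

Proves the improper FTC identity for ∫_c^∞ 1/(1-v²) when c > 1.

## Main Results

* `upper_integral_formula`: For c > 1, ∫ v in Ioi c, 1/(1-v²) = -(1/2)*(log(c+1) - log(c-1))

This is the key lemma for `artanh_integral_bound` in `stub_farLogKernelSharp`.

## References

Supports stmt-RiemannHypothesis-24730 (Remainder0Xi crux) via EarlyAppointments route.
-/

set_option linter.dupNamespace false
namespace Summit.RiemannHypothesis.RiemannHypothesis.Theorems.EarlyAppointmentsRemainder0Xi.UpperIntegral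

open Real MeasureTheory Set Filter Topology

/-- The antiderivative F(v) = (1/2)*(log(v+1) - log(v-1)) has derivative 1/(1-v²) for v > 1. -/
lemma hasDerivAt_artanh_extension {v : ℝ} (hv : 1 < v) :
    HasDerivAt (fun z => (1 / 2 : ℝ) * (Real.log (z + 1) - Real.log (z - 1)))
               ((1 : ℝ) / (1 - v ^ 2)) v := by
  have h1 : 0 < v + 1 := by linarith
  have h2 : 0 < v - 1 := by linarith
  have hne1 : v + 1 ≠ 0 := h1.ne'
  have hne2 : v - 1 ≠ 0 := h2.ne'
  have hne3 : 1 - v ^ 2 ≠ 0 := by nlinarith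
  have hd1 : HasDerivAt (fun z => Real.log (z + 1)) ((v + 1)⁻¹) v := by
    have hbase := Real.hasDerivAt_log h1.ne'
    have hcomp := hbase.comp v ((hasDerivAt_id v).add_const 1)
    simp only [id, mul_one] at hcomp
    exact hcomp
  have hd2 : HasDerivAt (fun z => Real.log (z - 1)) ((v - 1)⁻¹) v := by
    have hbase := Real.hasDerivAt_log h2.ne'
    have hcomp := hbase.comp v ((hasDerivAt_id v).sub_const 1)
    simp only [id, mul_one] at hcomp
    exact hcomp
  have hdsub := hd1.sub hd2
  have hdmul := hdsub.const_mul (1 / 2 : ℝ)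
  refine hdmul.congr_deriv ?_
  field_simp [hne1, hne2, hne3]
  ring

/-- The antiderivative F(v) = (1/2)*(log(v+1) - log(v-1)) tends to 0 as v → ∞. -/
lemma tendsto_artanh_extension_atTop :
    Tendsto (fun v => (1 / 2 : ℝ) * (Real.log (v + 1) - Real.log (v - 1))) atTop (𝓝 0) := by
  have hlim : Tendsto (fun v : ℝ => 2 / (v - 1)) atTop (𝓝 0) := by
    have h : Tendsto (fun v : ℝ => v - 1) atTop atTop :=
      tendsto_atTop_add_const_right atTop (-1) tendsto_id
    exact Tendsto.div_atTop tendsto_const_nhds h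
  have hlim2 : Tendsto (fun v : ℝ => 1 + 2 / (v - 1)) atTop (𝓝 1) := by
    simpa using hlim.const_add 1
  have hlog := (Real.continuousAt_log one_ne_zero).tendsto.comp hlim2
  simp only [Real.log_one] at hlog
  have hmain : Tendsto (fun v => (1 / 2 : ℝ) * Real.log (1 + 2 / (v - 1))) atTop (𝓝 0) := by
    simpa using hlog.const_mul (1 / 2 : ℝ)
  refine hmain.congr' ?_
  filter_upwards [eventually_gt_atTop (1 : ℝ)] with v hv
  have h1 : 0 < v + 1 := by linarith
  have h2 : 0 < v - 1 := by linarith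
  rw [← Real.log_div h1.ne' h2.ne']
  congr 1
  field_simp [h2.ne']
  ring

/-- The integrand 1/(1-v²) is integrable on (c, ∞) for c > 1. -/
lemma integrableOn_inv_one_sub_sq_Ioi {c : ℝ} (hc : 1 < c) :
    IntegrableOn (fun v => (1 : ℝ) / (1 - v ^ 2)) (Ioi c) := by
  have hc2 : 1 < max c 2 := lt_max_of_lt_left hc
  have hpos : 0 < max c 2 := lt_trans (by linarith : (0:ℝ) < 1) hc2
  -- On [c, max c 2] the function is continuous hence integrable
  have hint1 : IntegrableOn (fun v => (1 : ℝ) / (1 - v ^ 2)) (Ioc c (max c 2)) := by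
    have hcpt : IsCompact (Icc c (max c 2)) := isCompact_Icc
    have hsub : Ioc c (max c 2) ⊆ Icc c (max c 2) := Ioc_subset_Icc_self
    apply (ContinuousOn.integrableOn_compact hcpt ?_).mono_set hsub
    apply ContinuousOn.div continuousOn_const
    · exact (continuous_const.sub (continuous_pow 2)).continuousOn
    · intro v hv
      have hv1 : 1 < v := lt_of_lt_of_le hc hv.1
      nlinarith
  -- On (max c 2, ∞) compare to 2/v²
  have hint2 : IntegrableOn (fun v => (1 : ℝ) / (1 - v ^ 2)) (Ioi (max c 2)) := by
    have hcmp : ∀ v ∈ Ioi (max c 2), ‖(1 : ℝ) / (1 - v ^ 2)‖ ≤ 2 / v ^ 2 := by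
      intro v hv
      have hv2 : 2 < v := lt_of_le_of_lt (le_max_right c 2) hv
      have hvpos : 0 < v := by linarith
      have hvsq : v ^ 2 / 2 ≤ v ^ 2 - 1 := by nlinarith
      have hvsq_pos : 0 < v ^ 2 - 1 := by nlinarith
      have hneg : (1 : ℝ) / (1 - v ^ 2) < 0 := by
        apply div_neg_of_pos_of_neg one_pos
        nlinarith
      rw [Real.norm_eq_abs, abs_of_neg hneg]
      have heq : -((1 : ℝ) / (1 - v ^ 2)) = 1 / (v ^ 2 - 1) := by
        have hne : 1 - v ^ 2 ≠ 0 := by nlinarith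
        field_simp [hne]
        ring
      rw [heq]
      have h1 : 1 / (v ^ 2 - 1) ≤ 1 / (v ^ 2 / 2) := by
        apply div_le_div_of_nonneg_left (by norm_num) (by positivity) hvsq
      calc 1 / (v ^ 2 - 1) ≤ 1 / (v ^ 2 / 2) := h1
        _ = 2 / v ^ 2 := by field_simp
    -- ∫ 2/v² is integrable on (max c 2, ∞)
    have hint_rpow : IntegrableOn (fun v => (2 : ℝ) / v ^ 2) (Ioi (max c 2)) := by
      have h := integrableOn_Ioi_rpow_of_lt (by norm_num : (-2 : ℝ) < -1) hpos
      refine Integrable.mono' (h.const_mul 2) ?_ ?_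
      · exact ((measurable_const.div (measurable_id.pow_const 2)).aestronglyMeasurable)
      · filter_upwards [ae_restrict_mem measurableSet_Ioi] with v hv
        have hvpos : 0 < v := lt_trans hpos hv
        rw [Real.norm_eq_abs, abs_of_pos (by positivity)]
        simp only [Real.rpow_neg hvpos.le, sq, div_eq_mul_inv]
        have heq : v * v = v ^ 2 := by ring
        simp only [heq]; norm_cast
    refine Integrable.mono' hint_rpow
      ((measurable_const.div (measurable_const.sub (measurable_id.pow_const 2))).aestronglyMeasurable) ?_
    filter_upwards [ae_restrict_mem measurableSet_Ioi] with v hv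
    exact hcmp v hv
  -- Combine via union
  have hdecomp : Ioi c = Ioc c (max c 2) ∪ Ioi (max c 2) := by
    ext v
    simp only [mem_union, mem_Ioc, mem_Ioi]
    constructor
    · intro hv
      by_cases hv2 : v ≤ max c 2
      · left; exact ⟨hv, hv2⟩
      · right; exact not_le.mp hv2
    · intro h
      cases h with
      | inl h => exact h.1
      | inr h => exact lt_of_le_of_lt (le_max_left c 2) h
  rw [hdecomp]
  exact hint1.union hint2

/-- For c > 1, the improper integral ∫_c^∞ 1/(1-v²) equals -(1/2)*(log(c+1) - log(c-1)).

This is the key identity for computing the upper artanh integral in `artanh_integral_bound`. -/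
theorem upper_integral_formula {c : ℝ} (hc : 1 < c) :
    ∫ v in Ioi c, (1 : ℝ) / (1 - v ^ 2) = -(1 / 2) * (Real.log (c + 1) - Real.log (c - 1)) := by
  let F : ℝ → ℝ := fun v => (1 / 2) * (Real.log (v + 1) - Real.log (v - 1))

  have hcont : ContinuousWithinAt F (Ici c) c := by
    have h1 : 0 < c + 1 := by linarith
    have h2 : 0 < c - 1 := by linarith
    have hcontF : ContinuousOn F (Ioi 1) := by
      unfold F
      apply ContinuousOn.mul continuousOn_const
      apply ContinuousOn.sub
      · apply ContinuousOn.comp Real.continuousOn_log (continuous_id.add continuous_const).continuousOn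
        intro x hx; simp only [mem_Ioi, mem_compl_iff, mem_singleton_iff, id, Pi.add_apply] at hx ⊢
        linarith
      · apply ContinuousOn.comp Real.continuousOn_log (continuous_id.sub continuous_const).continuousOn
        intro x hx; simp only [mem_Ioi, mem_compl_iff, mem_singleton_iff, id, Pi.sub_apply] at hx ⊢
        linarith
    have hsub : Ici c ⊆ Ioi 1 := fun x hx => lt_of_lt_of_le hc hx
    exact (hcontF.mono hsub).continuousWithinAt (mem_Ici.mpr le_rfl)

  have hderiv : ∀ v ∈ Ioi c, HasDerivAt F ((1 : ℝ) / (1 - v ^ 2)) v := fun v hv =>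
    hasDerivAt_artanh_extension (lt_of_lt_of_le hc (le_of_lt hv))

  have hint := integrableOn_inv_one_sub_sq_Ioi hc

  have hlim : Tendsto F atTop (𝓝 0) := tendsto_artanh_extension_atTop

  have hFTC := integral_Ioi_of_hasDerivAt_of_tendsto hcont hderiv hint hlim
  rw [hFTC]
  simp only [F]
  ring

end Summit.RiemannHypothesis.RiemannHypothesis.Theorems.EarlyAppointmentsRemainder0Xi.UpperIntegral
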